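import Mathlib
import Literature.Analysis.ODE.RegularSingularScalarBranch
import HarnessLib

/-!
# The first-order system of `x y″ + p(x) y′ + q(x) y = 0` at a regular singular point, over `𝕜 = ℝ` or `ℂ`

Topic `Literature/Analysis/ODE` (namespace `Literature.Analysis.ODE`). The `RCLike` form of the system part of
`RegularSingularScalarBranch.lean` (which is stated over `ℂ` only): for `x y″ + p(x) y′ + q(x) y = 0`,
`p = Σ pₖ xᵏ`, `q = Σ qₖ xᵏ`, the vector `v = (y, y′)` solves `x v′ = (Σ xᵏ Mₖ) v` with
`M₀ = [[0, 0], [−q₀, −p₀]]`, `M₁ = [[0, 1], [−q₁, −p₁]]`, `Mₖ = [[0, 0], [−qₖ, −pₖ]]` (`k ≥ 2`), and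
`Rₙ = (n − M₀)⁻¹ = (1/(n(n + p₀))) [[n + p₀, 0], [−q₀, n]]` [cite: CoddingtonLevinson1955, Ch. 4 §8]. Working over a
general `RCLike 𝕜` is what lets REAL equations (e.g. the marginal tearing-mode equation on both sides of a rational
surface) be treated on the real line; over `ℂ` the objects are definitionally those of the `ℂ` file
(`scalarSysM_complex`, `scalarSysR_complex`).

* `scalarSysM pc qc`, `scalarSysR pc qc` — the operators and the inverses; `scalarSysM_apply`, `scalarSysR_apply`;
* `norm_scalarSysM_le`, `norm_scalarSysR_le` (`‖Rₙ‖ ≤ max 1 ((‖q₀‖ + 1)/μ)/n` under `μ n ≤ ‖n + p₀‖`),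
  `scalarSysR_rightInverse`, `scalarSysR_leftInverse` (the latter feeds `frobeniusCoeff_unique`: a certificate that
  checks finitely many computed coefficients against the cleared recursion identifies them with THE Frobenius
  coefficients);
* `isFrobeniusData_scalarSys` — the hypotheses of the vector theorem `IsFrobeniusData.analyticBranch` are met
  (`K' = 2K + a⁻¹`, `c = max 1 ((‖q₀‖ + 1)/μ)`, compatibility `q₀ y₀ + p₀ y₁ = 0`);
* `tsum_scalarSysM_apply` — `(Σ xᵏ • Mₖ)(w₁, w₂) = (x w₂, −q(x) w₁ − p(x) w₂)` inside the disc.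

Used by `RegularSingularLogBranchScalar.lean` (the resonant case `p₀ = 0`, logarithmic branch).

## References
* E. A. Coddington, N. Levinson, *Theory of Ordinary Differential Equations*, McGraw–Hill 1955, Ch. 4 §§3, 8.
  Key `CoddingtonLevinson1955`.
* P. Hartman, *Ordinary Differential Equations*, SIAM Classics 38 (2002), Ch. IV §12. Key `Hartman2002`.
-/

noncomputable section

open Finset Filter Metric
open scoped Topology NNReal ENNReal

namespace Literature.Analysis.ODE

variable {𝕜 : Type*} [RCLike 𝕜]

/-! ### The first-order system of `x y″ + p y′ + q y = 0` over `𝕜 = ℝ` or `ℂ` -/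

/-- The coefficient operators `Mₖ` of the system `x v′ = (Σ xᵏ Mₖ) v`, `v = (y, y′)`, of `x y″ + p y′ + q y = 0`
over `𝕜 = ℝ` or `ℂ`: `M₁ = [[0, 1], [−q₁, −p₁]]`, `Mₖ = [[0, 0], [−qₖ, −pₖ]]` (`k ≠ 1`). This is
`scalarBranchM` of `RegularSingularScalarBranch.lean` (stated there over `ℂ`) for a general `RCLike` field,
so that real equations can be treated on the real line (`scalarSysM_complex`). [cite: CoddingtonLevinson1955, Ch. 4 §8] -/
def scalarSysM (pc qc : ℕ → 𝕜) (k : ℕ) : 𝕜 × 𝕜 →L[𝕜] 𝕜 × 𝕜 :=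
  (if k = 1 then ContinuousLinearMap.snd 𝕜 𝕜 𝕜 else 0).prod
    (-(qc k) • ContinuousLinearMap.fst 𝕜 𝕜 𝕜 - (pc k) • ContinuousLinearMap.snd 𝕜 𝕜 𝕜)

/-- The inverse `Rₙ = (n − M₀)⁻¹ = (1/(n(n + p₀))) [[n + p₀, 0], [−q₀, n]]` over `𝕜 = ℝ` or `ℂ`
(`scalarBranchR` for general `RCLike`). [cite: CoddingtonLevinson1955, Ch. 4 §8] -/
def scalarSysR (pc qc : ℕ → 𝕜) (n : ℕ) : 𝕜 × 𝕜 →L[𝕜] 𝕜 × 𝕜 :=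
  ((n : 𝕜)⁻¹ • ContinuousLinearMap.fst 𝕜 𝕜 𝕜).prod
    (((n : 𝕜) * ((n : 𝕜) + pc 0))⁻¹ •
      (-(qc 0) • ContinuousLinearMap.fst 𝕜 𝕜 𝕜 + (n : 𝕜) • ContinuousLinearMap.snd 𝕜 𝕜 𝕜))

/-- Over `ℂ` these are the operators of `RegularSingularScalarBranch.lean`. [cite: CoddingtonLevinson1955, Ch. 4 §8] -/
theorem scalarSysM_complex (pc qc : ℕ → ℂ) : scalarSysM pc qc = scalarBranchM pc qc := rfl

/-- Over `ℂ` these are the inverses of `RegularSingularScalarBranch.lean`. [cite: CoddingtonLevinson1955, Ch. 4 §8] -/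
theorem scalarSysR_complex (pc qc : ℕ → ℂ) : scalarSysR pc qc = scalarBranchR pc qc := rfl

section System

variable (pc qc : ℕ → 𝕜)

/-- `Mₖ (w₁, w₂) = ([k = 1] w₂, −qₖ w₁ − pₖ w₂)`. [cite: CoddingtonLevinson1955, Ch. 4 §8] -/
@[simp] theorem scalarSysM_apply (k : ℕ) (w : 𝕜 × 𝕜) :
    scalarSysM pc qc k w = (if k = 1 then w.2 else 0, -(qc k) * w.1 - pc k * w.2) := by
  rcases eq_or_ne k 1 with rfl | hk
  · simp [scalarSysM]
  · simp [scalarSysM, hk]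

/-- `Rₙ (w₁, w₂) = (w₁/n, (−q₀ w₁ + n w₂)/(n(n + p₀)))`. [cite: CoddingtonLevinson1955, Ch. 4 §8] -/
@[simp] theorem scalarSysR_apply (n : ℕ) (w : 𝕜 × 𝕜) :
    scalarSysR pc qc n w =
      ((n : 𝕜)⁻¹ * w.1, ((n : 𝕜) * ((n : 𝕜) + pc 0))⁻¹ * (-(qc 0) * w.1 + (n : 𝕜) * w.2)) := by
  change ((n : 𝕜)⁻¹ • w.1, ((n : 𝕜) * ((n : 𝕜) + pc 0))⁻¹ • (-(qc 0) • w.1 + (n : 𝕜) • w.2)) = _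
  simp only [smul_eq_mul]

/-- `‖Mₖ‖ ≤ max [k = 1] (‖qₖ‖ + ‖pₖ‖)`. [cite: CoddingtonLevinson1955, Ch. 4 §3] -/
theorem norm_scalarSysM_le (k : ℕ) :
    ‖scalarSysM pc qc k‖ ≤ max (if k = 1 then 1 else 0) (‖qc k‖ + ‖pc k‖) := by
  rw [scalarSysM, ContinuousLinearMap.opNorm_prod, Prod.norm_mk]
  refine max_le_max ?_ ?_
  · split_ifs
    · exact ContinuousLinearMap.norm_snd_le 𝕜 𝕜 𝕜
    · simp
  · refine (norm_sub_le _ _).trans (add_le_add ?_ ?_)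
    · rw [norm_smul, norm_neg]
      exact mul_le_of_le_one_right (norm_nonneg _) (ContinuousLinearMap.norm_fst_le 𝕜 𝕜 𝕜)
    · rw [norm_smul]
      exact mul_le_of_le_one_right (norm_nonneg _) (ContinuousLinearMap.norm_snd_le 𝕜 𝕜 𝕜)

/-- `Rₙ` is a right inverse of `n − M₀` whenever `n ≠ 0` and `n + p₀ ≠ 0`. [cite: CoddingtonLevinson1955, Ch. 4 §8] -/
theorem scalarSysR_rightInverse {n : ℕ} (hn : n ≠ 0) (hp : (n : 𝕜) + pc 0 ≠ 0) (w : 𝕜 × 𝕜) :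
    (n : 𝕜) • scalarSysR pc qc n w - scalarSysM pc qc 0 (scalarSysR pc qc n w) = w := by
  have hn' : (n : 𝕜) ≠ 0 := Nat.cast_ne_zero.2 hn
  ext
  · simp only [scalarSysR_apply, scalarSysM_apply, Prod.smul_fst, Prod.fst_sub, smul_eq_mul]
    simp only [zero_ne_one, ↓reduceIte, sub_zero]
    field_simp
  · simp only [scalarSysR_apply, scalarSysM_apply, Prod.smul_snd, Prod.snd_sub, smul_eq_mul]
    field_simp
    ring

/-- `Rₙ` is a left inverse of `n − M₀` whenever `n ≠ 0` and `n + p₀ ≠ 0`. [cite: CoddingtonLevinson1955, Ch. 4 §8] -/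
theorem scalarSysR_leftInverse {n : ℕ} (hn : n ≠ 0) (hp : (n : 𝕜) + pc 0 ≠ 0) (w : 𝕜 × 𝕜) :
    scalarSysR pc qc n ((n : 𝕜) • w - scalarSysM pc qc 0 w) = w := by
  have hn' : (n : 𝕜) ≠ 0 := Nat.cast_ne_zero.2 hn
  ext
  · simp only [scalarSysR_apply, scalarSysM_apply, Prod.smul_fst, Prod.fst_sub, smul_eq_mul]
    simp only [zero_ne_one, ↓reduceIte, sub_zero]
    field_simp
  · simp only [scalarSysR_apply, scalarSysM_apply, Prod.smul_fst, Prod.fst_sub, Prod.smul_snd, Prod.snd_sub,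
      smul_eq_mul]
    simp only [zero_ne_one, ↓reduceIte, sub_zero]
    field_simp
    ring

/-- THE RESOLVENT BOUND: if `μ n ≤ ‖n + p₀‖` (`μ > 0`, `n ≥ 1`) then `‖Rₙ‖ ≤ max 1 ((‖q₀‖ + 1)/μ) / n`.
[cite: CoddingtonLevinson1955, Ch. 4 §3] -/
theorem norm_scalarSysR_le {μ : ℝ} (hμ : 0 < μ) {n : ℕ} (hn : 1 ≤ n) (hres : μ * n ≤ ‖(n : 𝕜) + pc 0‖) :
    ‖scalarSysR pc qc n‖ ≤ max 1 ((‖qc 0‖ + 1) / μ) / n := by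
  have hn0 : (0 : ℝ) < n := by exact_mod_cast hn
  have hn1 : (1 : ℝ) ≤ n := by exact_mod_cast hn
  have hP : 0 < ‖(n : 𝕜) + pc 0‖ := lt_of_lt_of_le (by positivity) hres
  refine ContinuousLinearMap.opNorm_le_bound _ (by positivity) fun w => ?_
  rw [scalarSysR_apply, Prod.norm_mk]
  have hw1 : ‖w.1‖ ≤ ‖w‖ := norm_fst_le w
  have hw2 : ‖w.2‖ ≤ ‖w‖ := norm_snd_le w
  have hw0 : 0 ≤ ‖w‖ := norm_nonneg w
  refine max_le ?_ ?_
  · rw [norm_mul, norm_inv, RCLike.norm_natCast]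
    calc (n : ℝ)⁻¹ * ‖w.1‖ ≤ (n : ℝ)⁻¹ * ‖w‖ := mul_le_mul_of_nonneg_left hw1 (by positivity)
      _ = 1 / n * ‖w‖ := by ring
      _ ≤ max 1 ((‖qc 0‖ + 1) / μ) / n * ‖w‖ :=
          mul_le_mul_of_nonneg_right (div_le_div_of_nonneg_right (le_max_left _ _) hn0.le) hw0
  · rw [norm_mul, norm_inv, norm_mul, RCLike.norm_natCast]
    have hnum : ‖-(qc 0) * w.1 + (n : 𝕜) * w.2‖ ≤ (‖qc 0‖ + n) * ‖w‖ := by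
      calc ‖-(qc 0) * w.1 + (n : 𝕜) * w.2‖ ≤ ‖-(qc 0) * w.1‖ + ‖(n : 𝕜) * w.2‖ := norm_add_le _ _
        _ = ‖qc 0‖ * ‖w.1‖ + n * ‖w.2‖ := by rw [norm_mul, norm_neg, norm_mul, RCLike.norm_natCast]
        _ ≤ ‖qc 0‖ * ‖w‖ + n * ‖w‖ := add_le_add (mul_le_mul_of_nonneg_left hw1 (norm_nonneg _))
            (mul_le_mul_of_nonneg_left hw2 hn0.le)
        _ = (‖qc 0‖ + n) * ‖w‖ := by ring
    calc ((n : ℝ) * ‖(n : 𝕜) + pc 0‖)⁻¹ * ‖-(qc 0) * w.1 + (n : 𝕜) * w.2‖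
        ≤ ((n : ℝ) * (μ * n))⁻¹ * ((‖qc 0‖ + n) * ‖w‖) := by
          refine mul_le_mul ?_ hnum (norm_nonneg _) (by positivity)
          exact inv_anti₀ (by positivity) (mul_le_mul_of_nonneg_left hres hn0.le)
      _ = ((‖qc 0‖ + n) / (μ * n)) / n * ‖w‖ := by
          field_simp
      _ ≤ max 1 ((‖qc 0‖ + 1) / μ) / n * ‖w‖ := by
          refine mul_le_mul_of_nonneg_right (div_le_div_of_nonneg_right ?_ hn0.le) hw0
          refine le_max_of_le_right ?_
          rw [div_le_div_iff₀ (by positivity) hμ]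
          have h5 : ‖qc 0‖ * μ * 1 ≤ ‖qc 0‖ * μ * n :=
            mul_le_mul_of_nonneg_left hn1 (mul_nonneg (norm_nonneg _) hμ.le)
          nlinarith [h5]

/-- The hypotheses of the vector Frobenius theorem are met by the system of `x y″ + p y′ + q y = 0` over `𝕜`
(`RCLike` form of `isFrobeniusData_scalar`). [cite: CoddingtonLevinson1955, Ch. 4 §§3–4] -/
theorem isFrobeniusData_scalarSys {a K μ : ℝ} (ha : 0 < a) (hK : 0 ≤ K) (hμ : 0 < μ)
    (hpc : ∀ k : ℕ, 1 ≤ k → ‖pc k‖ ≤ K * a ^ k) (hqc : ∀ k : ℕ, 1 ≤ k → ‖qc k‖ ≤ K * a ^ k)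
    (hres : ∀ n : ℕ, 1 ≤ n → μ * n ≤ ‖(n : 𝕜) + pc 0‖) {y₀ y₁ : 𝕜} (h0 : qc 0 * y₀ + pc 0 * y₁ = 0) :
    IsFrobeniusData (scalarSysM pc qc) (fun _ => 0) (scalarSysR pc qc) (y₀, y₁) a (2 * K + a⁻¹) 0
      (max 1 ((‖qc 0‖ + 1) / μ)) where
  a_nonneg := ha.le
  K_nonneg := by positivity
  G_nonneg := le_rfl
  c_nonneg := by positivity
  norm_M_le k hk := by
    refine (norm_scalarSysM_le pc qc k).trans (max_le ?_ ?_)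
    · split_ifs with h1
      · subst h1
        rw [pow_one, add_mul, inv_mul_cancel₀ ha.ne']
        nlinarith
      · positivity
    · calc ‖qc k‖ + ‖pc k‖ ≤ K * a ^ k + K * a ^ k := add_le_add (hqc k hk) (hpc k hk)
        _ = 2 * K * a ^ k := by ring
        _ ≤ (2 * K + a⁻¹) * a ^ k := by
            refine mul_le_mul_of_nonneg_right ?_ (pow_nonneg ha.le k)
            linarith [inv_pos.2 ha]
  norm_g_le k _ := by simp
  rightInverse n hn w := by
    have hP : 0 < ‖(n : 𝕜) + pc 0‖ := lt_of_lt_of_le (by positivity) (hres n hn)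
    exact scalarSysR_rightInverse pc qc (by omega) (norm_pos_iff.1 hP) w
  norm_R_le n hn := norm_scalarSysR_le pc qc hμ hn (hres n hn)
  compat := by
    rw [scalarSysM_apply, add_zero, Prod.mk_eq_zero]
    simp only [zero_ne_one, ↓reduceIte, true_and]
    linear_combination -h0

/-- EVALUATION of the operator series: for `‖pₖ‖, ‖qₖ‖ ≤ K' aᵏ` (all `k`), `a‖x‖ < 1`, and `p(x) = Σ xᵏ pₖ`,
`q(x) = Σ xᵏ qₖ`: `(Σ xᵏ • Mₖ) (w₁, w₂) = (x w₂, −q(x) w₁ − p(x) w₂)`. [cite: CoddingtonLevinson1955, Ch. 4 §8] -/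
theorem tsum_scalarSysM_apply {a K' : ℝ} (ha : 0 ≤ a) (hM : ∀ k, ‖scalarSysM pc qc k‖ ≤ K' * a ^ k)
    {x : 𝕜} (hx : a * ‖x‖ < 1) {px qx : 𝕜} (hp : HasSum (fun k => x ^ k * pc k) px)
    (hq : HasSum (fun k => x ^ k * qc k) qx) (w : 𝕜 × 𝕜) :
    (∑' k, x ^ k • scalarSysM pc qc k) w = (x * w.2, -qx * w.1 - px * w.2) := by
  have hS : HasSum (fun k => x ^ k • scalarSysM pc qc k) (∑' k, x ^ k • scalarSysM pc qc k) :=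
    (summable_norm_pow_smul hM ha hx).of_norm.hasSum
  have hSw : HasSum (fun k => (x ^ k • scalarSysM pc qc k) w) ((∑' k, x ^ k • scalarSysM pc qc k) w) := by
    simpa only [ContinuousLinearMap.apply_apply] using (ContinuousLinearMap.apply 𝕜 (𝕜 × 𝕜) w).hasSum hS
  have e1 : HasSum (fun k => ((x ^ k • scalarSysM pc qc k) w).1) (x * w.2) := by
    have : (fun k => ((x ^ k • scalarSysM pc qc k) w).1) = fun k => if k = 1 then x * w.2 else 0 := by
      funext k
      change (x ^ k • (scalarSysM pc qc k w)).1 = _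
      rw [scalarSysM_apply, Prod.smul_fst, smul_eq_mul]
      split_ifs with hk
      · rw [hk, pow_one]
      · rw [mul_zero]
    rw [this]
    exact hasSum_ite_eq 1 (x * w.2)
  have e2 : HasSum (fun k => ((x ^ k • scalarSysM pc qc k) w).2) (-qx * w.1 - px * w.2) := by
    have : (fun k => ((x ^ k • scalarSysM pc qc k) w).2) =
        fun k => -(x ^ k * qc k * w.1) - x ^ k * pc k * w.2 := by
      funext k
      change (x ^ k • (scalarSysM pc qc k w)).2 = _
      rw [scalarSysM_apply, Prod.smul_snd, smul_eq_mul]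
      ring
    rw [this]
    have h := ((hq.mul_right w.1).neg).sub (hp.mul_right w.2)
    have e : -qx * w.1 - px * w.2 = -(qx * w.1) - px * w.2 := by ring
    rw [e]
    exact h
  have e : HasSum (fun k => (x ^ k • scalarSysM pc qc k) w) (x * w.2, -qx * w.1 - px * w.2) := by
    simpa only [Prod.mk.eta] using e1.prodMk e2
  exact hSw.unique e

end System

end Literature.Analysis.ODE

end
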